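import Summits.QuantumFields.YangMills.Theorems.SwapVirialDeficitZeroModeSigmaFourSmallBallCone
import HarnessLib

/-!
# Exact zero-mode rung Z5 — the σ-TWISTED FOUR-LEADER small ball, I-b: hub straightened, slaved letter translated, hub Tonelli
# (LEAD ym-line-sfw-p2 g93 07:46Z «`Haar⁴{E_σ(t)} = v₇t⁷(1 + O(t^θ))`»; free-hands support of ⟨stmt-QuantumFields-24197⟩)

Continuing part I (`…SmallBallCone`: `Haar⁴(E_σ(t)) = coneFour (prodSigma t)` in the arranged cone coordinates `(a, ((x, y), z))`, hub
`a` = the seam letter `C 3`, slaved letter `z = C 1`), the two exact symmetry reductions of the σ-twisted four-leader event: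
* §4 HUB STRAIGHTENING — the six relations are invariant under simultaneous conjugation by a unit quaternion (`mem_sigmaSet_conj`); conjugating
  the three non-hub letters by the cone conjugator of `a` is a skew product of ✓`ZeroModeGroup.measurePreserving_conjIso_cone`
  (`measurePreserving_straighten`) and replaces the hub by its AXIAL unit `A = radialUnit (axisPoint a) = (re a + ‖Im a‖·i)/‖a‖`:
  ★ `haar_sigmaBall_eq_axis`;
* §5 THE SLAVED LETTER — left translation of `z` by the unit `p = Ā·x̂·A` (`slaveP`), a skew product over `(a, (x, y))` of the left invariance
  of the cone measure (✓`SU2Haar.map_mul_left_restrict_ball`; `measurePreserving_translate`, `measurePreserving_translate_skew`):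
  ★★ `haar_sigmaBall_eq_translated` and, by Tonelli over the hub, ★★ `haar_sigmaBall_eq_lintegral`
  `Haar⁴(E_σ(t)) = ∫ coneThree (transSet t (radialUnit (axisPoint a))) dcone(a)`;
* §6 the two seam relations after translation: ★ `norm_seam0_translate` (`‖A(pẑ) − x̂A‖ = ‖ẑ − 1‖`: the slaved letter lives in the
  `t`-ball about `1`) and `norm_seam1_translate` (`‖Ax̂ − (pẑ)A‖ = ‖p̄(Ax̂Ā) − ẑ‖`).
Parts II–V: dilations (Jacobian `t⁷`), the limit event, the dominator from the four load-bearing constraints of LEAD g93's ceiling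
(✓`SigmaTwistedCeiling.abs_re_mul_norm_comm_le`, ✓`norm_comm_conj_le`), dominated convergence.
HONEST LABEL: finite-dimensional measure theory on `SU(2)⁴` (plan-level zero-mode rung of the DRAFT line «sharp-sigma»); NOT the fixed-`L` sharp law,
NOT ⟨24197⟩; own crux ⟨22884⟩ OPEN (blocked-on ⟨19935⟩); the Yang–Mills mass gap is NOT proved; no summit is proved by a line.
Width seat ym-line-sfw-p2-w3 g63 (cell ym-idea-1, free hands), `--supports stmt-QuantumFields-24197`.  Standard axioms, 0 `sorry`.
References: [cite: GonzalezarroyoAltes1988]; [cite: Vanbaal2001]; [cite: Luscher1983, §2]; [folklore].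
-/

set_option autoImplicit false

noncomputable section

open MeasureTheory Quaternion Set
open scoped Quaternion ENNReal BigOperators
open Literature.MathematicalPhysics.QuantumLattice
open Literature.MathematicalPhysics.QuantumFieldTheory (haarProbability)
open Literature.Analysis.Calculus (radialUnit radialUnit_def norm_radialUnit)
open Summit.QuantumFields.YangMills.Theorems.SwapTwistDeficit.ToronLog
open Summit.QuantumFields.YangMills.Theorems.ToronValleyVolume.NearlyCommutingCeiling (norm_conj_of_norm_eq_one comm_conj_of_norm_eq_one)
open Summit.QuantumFields.YangMills.Theorems.SwapVirialDeficit.ZeroModeGroup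

attribute [local instance] Literature.Analysis.FluidPDE.Tao2016.quatMeasurableSpace
  Literature.Analysis.FluidPDE.Tao2016.quatBorelSpace
  Literature.MathematicalPhysics.QuantumLattice.secondCountableTopology_su2

namespace Summit.QuantumFields.YangMills.Theorems.SwapVirialDeficit.ZeroModeSigma

/-! ## §4 Straightening the hub -/

/-- `(ū a u)(ū b u) = ū (ab) u` for a unit `u`. [folklore] -/
theorem conj_mul_conj {u : ℍ} (hu : ‖u‖ = 1) (a b : ℍ) : (star u * a * u) * (star u * b * u) = star u * (a * b) * u := by
  -- `u ū = 1` (✓`FibreLocalInverse.self_mul_star_of_norm_eq_one`, inlined to keep the import closure small)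
  have hus : u * star u = 1 := by
    rw [Quaternion.self_mul_star, Quaternion.normSq_eq_norm_mul_self, hu, mul_one, Quaternion.coe_one]
  calc (star u * a * u) * (star u * b * u) = star u * a * (u * star u) * b * u := by simp only [mul_assoc]
    _ = star u * (a * b) * u := by rw [hus]; simp only [mul_one, mul_assoc]

/-- `‖(ū a u)(ū b u) − (ū c u)(ū d u)‖ = ‖ab − cd‖` for a unit `u`. [folklore] -/
theorem norm_conj_mul_sub_conj_mul {u : ℍ} (hu : ‖u‖ = 1) (a b c d : ℍ) :
    ‖(star u * a * u) * (star u * b * u) - (star u * c * u) * (star u * d * u)‖ = ‖a * b - c * d‖ := by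
  rw [conj_mul_conj hu, conj_mul_conj hu, ← norm_conj_of_norm_eq_one hu (a * b - c * d), mul_sub, sub_mul]

/-- ★ **The six relations are invariant under simultaneous conjugation** of the four letters by a unit quaternion. [folklore] -/
theorem mem_sigmaSet_conj {u : ℍ} (hu : ‖u‖ = 1) (t : ℝ) (q₀ q₁ q₂ q₃ : ℍ) :
    (star u * q₀ * u, star u * q₁ * u, star u * q₂ * u, star u * q₃ * u) ∈ sigmaSet t ↔ (q₀, q₁, q₂, q₃) ∈ sigmaSet t := by
  simp only [mem_sigmaSet_iff, norm_conj_mul_sub_conj_mul hu]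

/-- The straightening unit of the hub: `u(a) = q(a)/‖q(a)‖` (✓`ToronLog.coneQ`); a unit whenever `q(a) ≠ 0`, i.e. cone-a.e.
(✓`ZeroModeGroup.ae_coneQ_ne_zero`, ✓`norm_unitConeQ`). [folklore] -/
def hubUnit (a : ℍ) : ℍ := ‖coneQ a‖⁻¹ • coneQ a

/-- Unfolding `hubUnit`. [folklore] -/
theorem hubUnit_def (a : ℍ) : hubUnit a = ‖coneQ a‖⁻¹ • coneQ a := rfl

/-- `hubUnit` is measurable. [folklore] -/
theorem measurable_hubUnit : Measurable hubUnit := by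
  have h : hubUnit = fun a => ‖coneQ a‖⁻¹ • coneQ a := rfl
  rw [h]
  exact ((continuous_norm.comp continuous_coneQ).measurable.inv).smul continuous_coneQ.measurable

/-- Simultaneous conjugation of the three non-hub letters `((x, y), z)`. [folklore] -/
def conj3 (u : ℍ) (w : (ℍ × ℍ) × ℍ) : (ℍ × ℍ) × ℍ := ((star u * w.1.1 * u, star u * w.1.2 * u), star u * w.2 * u)

/-- Unfolding `conj3`. [folklore] -/
theorem conj3_apply (u : ℍ) (w : (ℍ × ℍ) × ℍ) : conj3 u w = ((star u * w.1.1 * u, star u * w.1.2 * u), star u * w.2 * u) := rfl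

/-- `(u, w) ↦ conj3 u w` is continuous. [folklore] -/
theorem continuous_conj3 : Continuous fun p : ℍ × ((ℍ × ℍ) × ℍ) => conj3 p.1 p.2 := by
  have h : (fun p : ℍ × ((ℍ × ℍ) × ℍ) => conj3 p.1 p.2) =
      fun p => ((star p.1 * p.2.1.1 * p.1, star p.1 * p.2.1.2 * p.1), star p.1 * p.2.2 * p.1) := rfl
  rw [h]
  fun_prop

/-- For a unit `u`, `conj3 u` preserves `coneThree`. [folklore] -/
theorem measurePreserving_conj3 {u : ℍ} (hu : ‖u‖ = 1) : MeasurePreserving (conj3 u) coneThree coneThree := by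
  haveI := isProbabilityMeasure_coneMeasure
  have h := ((measurePreserving_conjIso_cone u hu).prod (measurePreserving_conjIso_cone u hu)).prod (measurePreserving_conjIso_cone u hu)
  have heq : (Prod.map (Prod.map (conjIso u hu) (conjIso u hu)) (conjIso u hu)) = conj3 u := by
    funext w
    rcases w with ⟨⟨x, y⟩, z⟩
    simp only [Prod.map_apply, conjIso_apply, conj3]
  rw [heq] at h
  rw [coneThree_def]
  exact h

/-- ★ **The straightening skew product** `(a, w) ↦ (a, conj3 (u(a)) w)` preserves `coneFour`. [folklore] -/
theorem measurePreserving_straighten :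
    MeasurePreserving (fun q : ℍ × ((ℍ × ℍ) × ℍ) => (q.1, conj3 (hubUnit q.1) q.2)) coneFour coneFour := by
  haveI := isProbabilityMeasure_coneMeasure
  haveI := isProbabilityMeasure_coneThree
  have hgm : Measurable (Function.uncurry fun (a : ℍ) (w : (ℍ × ℍ) × ℍ) => conj3 (hubUnit a) w) := by
    have e : (Function.uncurry fun (a : ℍ) (w : (ℍ × ℍ) × ℍ) => conj3 (hubUnit a) w) =
        fun p : ℍ × ((ℍ × ℍ) × ℍ) => ((star (hubUnit p.1) * p.2.1.1 * hubUnit p.1, star (hubUnit p.1) * p.2.1.2 * hubUnit p.1),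
          star (hubUnit p.1) * p.2.2 * hubUnit p.1) := rfl
    rw [e]
    have hu : Measurable fun p : ℍ × ((ℍ × ℍ) × ℍ) => hubUnit p.1 := measurable_hubUnit.comp measurable_fst
    have hsu : Measurable fun p : ℍ × ((ℍ × ℍ) × ℍ) => star (hubUnit p.1) := continuous_star.measurable.comp hu
    exact (((hsu.mul (measurable_fst.comp (measurable_fst.comp measurable_snd))).mul hu).prodMk
      ((hsu.mul (measurable_snd.comp (measurable_fst.comp measurable_snd))).mul hu)).prodMk
      ((hsu.mul (measurable_snd.comp measurable_snd)).mul hu)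
  have hg : ∀ᵐ a : ℍ ∂coneMeasure, Measure.map ((fun (a : ℍ) (w : (ℍ × ℍ) × ℍ) => conj3 (hubUnit a) w) a) coneThree = coneThree := by
    filter_upwards [ae_coneQ_ne_zero] with a ha
    exact (measurePreserving_conj3 (norm_unitConeQ ha)).map_eq
  have h := (MeasurePreserving.id coneMeasure).skew_product hgm hg
  rw [coneFour]
  exact h

/-- The event with the hub replaced by its axial unit `A = radialUnit (axisPoint a)`. [folklore] -/
def axisSigma (t : ℝ) : Set (ℍ × ((ℍ × ℍ) × ℍ)) :=
  {q | (radialUnit q.2.1.1, radialUnit q.2.2, radialUnit q.2.1.2, radialUnit (axisPoint q.1)) ∈ sigmaSet t}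

/-- `axisPoint` is continuous. [folklore] -/
theorem continuous_axisPoint : Continuous axisPoint := by
  have h : axisPoint = fun y : ℍ => (⟨y.re, ‖y.im‖, 0, 0⟩ : ℍ) := rfl
  rw [h]
  exact continuous_quat_mk Quaternion.continuous_re (continuous_norm.comp Quaternion.continuous_im) continuous_const continuous_const

/-- The axial hub unit `a ↦ radialUnit (axisPoint a)` is measurable. [folklore] -/
theorem measurable_axisUnit : Measurable fun a : ℍ => radialUnit (axisPoint a) :=
  measurable_radialUnit.comp continuous_axisPoint.measurable

/-- `axisSigma t` is measurable. [folklore] -/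
theorem measurableSet_axisSigma (t : ℝ) : MeasurableSet (axisSigma t) :=
  measurableSet_preimage_sigmaSet t (measurable_radialUnit.comp (measurable_fst.comp (measurable_fst.comp measurable_snd)))
    (measurable_radialUnit.comp (measurable_snd.comp measurable_snd))
    (measurable_radialUnit.comp (measurable_snd.comp (measurable_fst.comp measurable_snd))) (measurable_axisUnit.comp measurable_fst)

/-- The straightening conjugation sends `radialUnit a` to `radialUnit (axisPoint a)`. [folklore] -/
theorem conj_hubUnit_radialUnit {a : ℍ} (ha : coneQ a ≠ 0) :
    star (hubUnit a) * radialUnit a * hubUnit a = radialUnit (axisPoint a) := by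
  rw [hubUnit_def, ← radialUnit_conj (norm_unitConeQ ha), conj_unitConeQ_self ha]

/-- ★ **Hub straightening**: `coneFour (prodSigma t) = coneFour (axisSigma t)` — the hub may be taken to be the axial unit
`(re a + ‖Im a‖·i)/‖a‖`. [folklore] -/
theorem coneFour_prodSigma_eq_axisSigma (t : ℝ) : coneFour (prodSigma t) = coneFour (axisSigma t) := by
  rw [← measurePreserving_straighten.measure_preimage (measurableSet_axisSigma t).nullMeasurableSet]
  refine measure_congr ?_
  filter_upwards [ae_coneFour_good] with q hq
  obtain ⟨ha, -, -, -, -⟩ := hq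
  have hu : ‖hubUnit q.1‖ = 1 := norm_unitConeQ ha
  simp only [eq_iff_iff]
  change q ∈ prodSigma t ↔ (q.1, conj3 (hubUnit q.1) q.2) ∈ axisSigma t
  simp only [prodSigma, axisSigma, conj3, Set.mem_setOf_eq]
  rw [radialUnit_conj hu, radialUnit_conj hu, radialUnit_conj hu, ← conj_hubUnit_radialUnit ha, mem_sigmaSet_conj hu]

/-- ★ `Haar⁴(E_σ(t)) = coneFour (axisSigma t)` (`t ≥ 0`). [folklore] -/
theorem haar_sigmaBall_eq_axis {t : ℝ} (ht : 0 ≤ t) :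
    (Measure.pi fun _ : Fin 4 => haarProbability (Matrix.specialUnitaryGroup (Fin 2) ℂ)) (sigmaBall t) = coneFour (axisSigma t) := by
  rw [haar_sigmaBall_eq_prod ht, coneFour_prodSigma_eq_axisSigma]

/-! ## §5 The slaved letter: left translation by `p = Ā·x̂·A` -/

/-- **The slaving unit** `p = Ā·x̂·A` (`A` the axial hub unit, `x̂ = radialUnit x`): the first seam relation `‖A q₁ − x̂ A‖ ≤ t` says that the slaved
letter `q₁` lies in the `t`-ball about `p` (✓`SigmaTwistedCeiling.norm_sub_conj_eq`). [folklore] -/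
def slaveP (A x : ℍ) : ℍ := star A * radialUnit x * A

/-- Unfolding `slaveP`. [folklore] -/
theorem slaveP_def (A x : ℍ) : slaveP A x = star A * radialUnit x * A := rfl

/-- `‖slaveP A x‖ = 1` for a unit `A` and `x ≠ 0`. [folklore] -/
theorem norm_slaveP {A x : ℍ} (hA : ‖A‖ = 1) (hx : x ≠ 0) : ‖slaveP A x‖ = 1 := by
  rw [slaveP, norm_conj_of_norm_eq_one hA, norm_radialUnit hx]

/-- `slaveP` is jointly measurable. [folklore] -/
theorem measurable_slaveP : Measurable fun p : ℍ × ℍ => slaveP p.1 p.2 := by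
  have h : (fun p : ℍ × ℍ => slaveP p.1 p.2) = fun p => star p.1 * radialUnit p.2 * p.1 := rfl
  rw [h]
  exact ((continuous_star.measurable.comp measurable_fst).mul (measurable_radialUnit.comp measurable_snd)).mul measurable_fst

/-- **Left invariance of the cone measure** under multiplication by a unit quaternion (✓`SU2Haar.map_mul_left_restrict_ball`). [folklore] -/
theorem map_mul_left_coneMeasure {p : ℍ} (hp : ‖p‖ = 1) : coneMeasure.map (fun z => p * z) = coneMeasure := by
  rw [coneMeasure, Measure.map_smul, map_mul_left_restrict_ball hp]

/-- The translation of the slaved letter `((x, y), z) ↦ ((x, y), p(A, x)·z)`. [folklore] -/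
def translate (A : ℍ) (w : (ℍ × ℍ) × ℍ) : (ℍ × ℍ) × ℍ := (w.1, slaveP A w.1.1 * w.2)

/-- Unfolding `translate`. [folklore] -/
theorem translate_apply (A : ℍ) (w : (ℍ × ℍ) × ℍ) : translate A w = (w.1, slaveP A w.1.1 * w.2) := rfl

/-- `(A, w) ↦ translate A w` is measurable. [folklore] -/
theorem measurable_translate : Measurable fun p : ℍ × ((ℍ × ℍ) × ℍ) => translate p.1 p.2 := by
  have h : (fun p : ℍ × ((ℍ × ℍ) × ℍ) => translate p.1 p.2) = fun p => (p.2.1, slaveP p.1 p.2.1.1 * p.2.2) := rfl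
  rw [h]
  refine (measurable_fst.comp measurable_snd).prodMk ?_
  exact (measurable_slaveP.comp (measurable_fst.prodMk (measurable_fst.comp (measurable_fst.comp measurable_snd)))).mul
    (measurable_snd.comp measurable_snd)

/-- For a unit `A`, `translate A` preserves `coneThree` (a skew product over `(x, y)` of left translations of the cone measure). [folklore] -/
theorem measurePreserving_translate {A : ℍ} (hA : ‖A‖ = 1) : MeasurePreserving (translate A) coneThree coneThree := by
  haveI := isProbabilityMeasure_coneMeasure
  have hgm : Measurable (Function.uncurry fun (w : ℍ × ℍ) (z : ℍ) => slaveP A w.1 * z) :=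
    (measurable_slaveP.comp (measurable_const.prodMk (measurable_fst.comp measurable_fst))).mul measurable_snd
  have hg : ∀ᵐ w : ℍ × ℍ ∂(coneMeasure.prod coneMeasure),
      Measure.map ((fun (w : ℍ × ℍ) (z : ℍ) => slaveP A w.1 * z) w) coneMeasure = coneMeasure := by
    have h1 : ∀ᵐ w : ℍ × ℍ ∂(coneMeasure.prod coneMeasure), w.1 ≠ 0 := Measure.quasiMeasurePreserving_fst.ae ae_ne_zero_coneMeasure
    filter_upwards [h1] with w hw
    exact map_mul_left_coneMeasure (norm_slaveP hA hw)
  have h := (MeasurePreserving.id (coneMeasure.prod coneMeasure)).skew_product hgm hg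
  rw [coneThree_def]
  exact h

/-- `radialUnit (axisPoint a)` is a unit for `a ≠ 0` (`‖axisPoint a‖ = ‖a‖`, ✓`norm_axisPoint`). [folklore] -/
theorem norm_axisUnit {a : ℍ} (ha : a ≠ 0) : ‖radialUnit (axisPoint a)‖ = 1 := by
  have h : axisPoint a ≠ 0 := by
    intro h0
    have h1 : ‖axisPoint a‖ = ‖a‖ := norm_axisPoint a
    rw [h0, norm_zero] at h1
    exact ha (norm_eq_zero.1 h1.symm)
  exact norm_radialUnit h

/-- ★ **The translation skew product** `(a, w) ↦ (a, translate (radialUnit (axisPoint a)) w)` preserves `coneFour`. [folklore] -/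
theorem measurePreserving_translate_skew :
    MeasurePreserving (fun q : ℍ × ((ℍ × ℍ) × ℍ) => (q.1, translate (radialUnit (axisPoint q.1)) q.2)) coneFour coneFour := by
  haveI := isProbabilityMeasure_coneMeasure
  haveI := isProbabilityMeasure_coneThree
  have hgm : Measurable (Function.uncurry fun (a : ℍ) (w : (ℍ × ℍ) × ℍ) => translate (radialUnit (axisPoint a)) w) :=
    measurable_translate.comp ((measurable_axisUnit.comp measurable_fst).prodMk measurable_snd)
  have hg : ∀ᵐ a : ℍ ∂coneMeasure,
      Measure.map ((fun (a : ℍ) (w : (ℍ × ℍ) × ℍ) => translate (radialUnit (axisPoint a)) w) a) coneThree = coneThree := by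
    filter_upwards [ae_ne_zero_coneMeasure] with a ha
    exact (measurePreserving_translate (norm_axisUnit ha)).map_eq
  have h := (MeasurePreserving.id coneMeasure).skew_product hgm hg
  rw [coneFour]
  exact h

/-- ★ **The translated event**: hub = axial unit `A = radialUnit (axisPoint a)`, slaved letter entered as `p·ẑ`, `p = slaveP A x`. [folklore] -/
def transSigma (t : ℝ) : Set (ℍ × ((ℍ × ℍ) × ℍ)) :=
  {q | (radialUnit q.2.1.1, slaveP (radialUnit (axisPoint q.1)) q.2.1.1 * radialUnit q.2.2, radialUnit q.2.1.2,
    radialUnit (axisPoint q.1)) ∈ sigmaSet t}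

/-- Its section at the axial hub unit `A`: `transSet t A ⊆ (ℍ × ℍ) × ℍ`. [folklore] -/
def transSet (t : ℝ) (A : ℍ) : Set ((ℍ × ℍ) × ℍ) :=
  {w | (radialUnit w.1.1, slaveP A w.1.1 * radialUnit w.2, radialUnit w.1.2, A) ∈ sigmaSet t}

/-- Unfolding membership in `transSet`. [folklore] -/
theorem mem_transSet_iff (t : ℝ) (A : ℍ) (w : (ℍ × ℍ) × ℍ) :
    w ∈ transSet t A ↔ (radialUnit w.1.1, slaveP A w.1.1 * radialUnit w.2, radialUnit w.1.2, A) ∈ sigmaSet t := Iff.rfl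

/-- `transSigma t` is measurable. [folklore] -/
theorem measurableSet_transSigma (t : ℝ) : MeasurableSet (transSigma t) := by
  have hA : Measurable fun q : ℍ × ((ℍ × ℍ) × ℍ) => radialUnit (axisPoint q.1) := measurable_axisUnit.comp measurable_fst
  have hx : Measurable fun q : ℍ × ((ℍ × ℍ) × ℍ) => q.2.1.1 := measurable_fst.comp (measurable_fst.comp measurable_snd)
  refine measurableSet_preimage_sigmaSet t (measurable_radialUnit.comp hx) ?_
    (measurable_radialUnit.comp (measurable_snd.comp (measurable_fst.comp measurable_snd))) hA
  exact (measurable_slaveP.comp (hA.prodMk hx)).mul (measurable_radialUnit.comp (measurable_snd.comp measurable_snd))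

/-- `transSet t A` is measurable. [folklore] -/
theorem measurableSet_transSet (t : ℝ) (A : ℍ) : MeasurableSet (transSet t A) := by
  have hx : Measurable fun w : (ℍ × ℍ) × ℍ => w.1.1 := measurable_fst.comp measurable_fst
  refine measurableSet_preimage_sigmaSet t (measurable_radialUnit.comp hx) ?_ (measurable_radialUnit.comp (measurable_snd.comp measurable_fst))
    measurable_const
  exact (measurable_slaveP.comp (measurable_const.prodMk hx)).mul (measurable_radialUnit.comp measurable_snd)

/-- ★★ **Translation of the slaved letter**: `coneFour (axisSigma t) = coneFour (transSigma t)`. [folklore] -/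
theorem coneFour_axisSigma_eq_transSigma (t : ℝ) : coneFour (axisSigma t) = coneFour (transSigma t) := by
  rw [← measurePreserving_translate_skew.measure_preimage (measurableSet_axisSigma t).nullMeasurableSet]
  refine measure_congr ?_
  filter_upwards [ae_coneFour_good] with q hq
  obtain ⟨-, ha, hx, -, -⟩ := hq
  have hp : ‖slaveP (radialUnit (axisPoint q.1)) q.2.1.1‖ = 1 := norm_slaveP (norm_axisUnit ha) hx
  simp only [eq_iff_iff]
  change (q.1, translate (radialUnit (axisPoint q.1)) q.2) ∈ axisSigma t ↔ q ∈ transSigma t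
  simp only [axisSigma, transSigma, translate, Set.mem_setOf_eq, radialUnit_mul_left hp]

/-- ★★ **`Haar⁴(E_σ(t))` after both reductions**: `= coneFour (transSigma t)` (`t ≥ 0`). [folklore] -/
theorem haar_sigmaBall_eq_translated {t : ℝ} (ht : 0 ≤ t) :
    (Measure.pi fun _ : Fin 4 => haarProbability (Matrix.specialUnitaryGroup (Fin 2) ℂ)) (sigmaBall t) = coneFour (transSigma t) := by
  rw [haar_sigmaBall_eq_axis ht, coneFour_axisSigma_eq_transSigma]

/-- The hub sections of `transSigma t` are the sets `transSet t (radialUnit (axisPoint a))`. [folklore] -/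
theorem prodMk_preimage_transSigma (t : ℝ) (a : ℍ) : Prod.mk a ⁻¹' transSigma t = transSet t (radialUnit (axisPoint a)) := by
  ext w; rfl

/-- ★★ **Hub Tonelli**: `Haar⁴(E_σ(t)) = ∫ coneThree (transSet t (radialUnit (axisPoint a))) dcone(a)` (`t ≥ 0`) — the seam letter as hub,
read through `(re a, ‖Im a‖)` only. [folklore] -/
theorem haar_sigmaBall_eq_lintegral {t : ℝ} (ht : 0 ≤ t) :
    (Measure.pi fun _ : Fin 4 => haarProbability (Matrix.specialUnitaryGroup (Fin 2) ℂ)) (sigmaBall t) =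
      ∫⁻ a, coneThree (transSet t (radialUnit (axisPoint a))) ∂coneMeasure := by
  haveI := isProbabilityMeasure_coneMeasure
  haveI := isProbabilityMeasure_coneThree
  rw [haar_sigmaBall_eq_translated ht, coneFour, Measure.prod_apply (measurableSet_transSigma t)]
  simp only [prodMk_preimage_transSigma]

/-! ## §6 The two seam relations after translation -/

/-- ★ **The first seam relation after translation is the ball about `1`**: `‖A·(p·w) − x̂·A‖ = ‖w − 1‖` for units `A`, `x̂ = radialUnit x`
(`x ≠ 0`), `p = slaveP A x`, and any `w`. [folklore] -/
theorem norm_seam0_translate {A x : ℍ} (hA : ‖A‖ = 1) (hx : x ≠ 0) (w : ℍ) :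
    ‖A * (slaveP A x * w) - radialUnit x * A‖ = ‖w - 1‖ := by
  have hAA : A * star A = 1 := by
    rw [Quaternion.self_mul_star, Quaternion.normSq_eq_norm_mul_self, hA, mul_one, Quaternion.coe_one]
  have h1 : A * (slaveP A x * w) = radialUnit x * A * w := by
    rw [slaveP]
    calc A * (star A * radialUnit x * A * w) = (A * star A) * radialUnit x * A * w := by simp only [mul_assoc]
      _ = radialUnit x * A * w := by rw [hAA, one_mul]
  rw [h1, ← mul_sub_one, norm_mul, norm_mul, norm_radialUnit hx, hA, one_mul, one_mul]

/-- The second seam relation after translation, as a ball about `w₁ = p̄·(A x̂ Ā)`: `‖A·x̂ − (p·w)·A‖ = ‖p̄·(A·x̂·Ā) − w‖` (units `A`, `x ≠ 0`).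
[folklore] -/
theorem norm_seam1_translate {A x : ℍ} (hA : ‖A‖ = 1) (hx : x ≠ 0) (w : ℍ) :
    ‖A * radialUnit x - slaveP A x * w * A‖ = ‖star (slaveP A x) * (A * radialUnit x * star A) - w‖ := by
  have hp : ‖slaveP A x‖ = 1 := norm_slaveP hA hx
  have hpp : slaveP A x * star (slaveP A x) = 1 := by
    rw [Quaternion.self_mul_star, Quaternion.normSq_eq_norm_mul_self, hp, mul_one, Quaternion.coe_one]
  have hAA' : star A * A = 1 := by
    rw [Quaternion.star_mul_self, Quaternion.normSq_eq_norm_mul_self, hA, mul_one, Quaternion.coe_one]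
  have h : A * radialUnit x - slaveP A x * w * A = slaveP A x * (star (slaveP A x) * (A * radialUnit x * star A) - w) * A := by
    rw [mul_sub, sub_mul]
    congr 1
    calc A * radialUnit x = A * radialUnit x * (star A * A) := by rw [hAA', mul_one]
      _ = (slaveP A x * star (slaveP A x)) * (A * radialUnit x * star A) * A := by rw [hpp, one_mul]; simp only [mul_assoc]
      _ = slaveP A x * (star (slaveP A x) * (A * radialUnit x * star A)) * A := by simp only [mul_assoc]
  rw [h, norm_mul, norm_mul, hp, hA, one_mul, mul_one]

/-- The centre of that second ball is within `‖A² x̂ − x̂ A²‖` of `1`: `‖p̄·(A x̂ Ā) − 1‖ = ‖A·A·x̂ − x̂·A·A‖` (units `A`, `x ≠ 0`). [folklore] -/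
theorem norm_seam1_centre_sub_one {A x : ℍ} (hA : ‖A‖ = 1) (hx : x ≠ 0) :
    ‖star (slaveP A x) * (A * radialUnit x * star A) - 1‖ = ‖A * A * radialUnit x - radialUnit x * A * A‖ := by
  have hp : ‖slaveP A x‖ = 1 := norm_slaveP hA hx
  have hpp : slaveP A x * star (slaveP A x) = 1 := by
    rw [Quaternion.self_mul_star, Quaternion.normSq_eq_norm_mul_self, hp, mul_one, Quaternion.coe_one]
  have hAA : A * star A = 1 := by
    rw [Quaternion.self_mul_star, Quaternion.normSq_eq_norm_mul_self, hA, mul_one, Quaternion.coe_one]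
  have hAA' : star A * A = 1 := by
    rw [Quaternion.star_mul_self, Quaternion.normSq_eq_norm_mul_self, hA, mul_one, Quaternion.coe_one]
  -- multiply on the left by `p` and on the right by `A`; both are units
  have h : slaveP A x * (star (slaveP A x) * (A * radialUnit x * star A) - 1) * A = A * radialUnit x - star A * radialUnit x * A * A := by
    rw [mul_sub, sub_mul, mul_one]
    congr 1
    calc slaveP A x * (star (slaveP A x) * (A * radialUnit x * star A)) * A
        = (slaveP A x * star (slaveP A x)) * (A * radialUnit x) * (star A * A) := by simp only [mul_assoc]
      _ = A * radialUnit x := by rw [hpp, hAA', one_mul, mul_one]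
  have h2 : A * (A * radialUnit x - star A * radialUnit x * A * A) = A * A * radialUnit x - radialUnit x * A * A := by
    rw [mul_sub]
    congr 1
    · rw [mul_assoc]
    · calc A * (star A * radialUnit x * A * A) = (A * star A) * radialUnit x * A * A := by simp only [mul_assoc]
        _ = radialUnit x * A * A := by rw [hAA, one_mul]
  calc ‖star (slaveP A x) * (A * radialUnit x * star A) - 1‖
      = ‖slaveP A x * (star (slaveP A x) * (A * radialUnit x * star A) - 1) * A‖ := by
        rw [norm_mul, norm_mul, hp, hA, one_mul, mul_one]
    _ = ‖A * radialUnit x - star A * radialUnit x * A * A‖ := by rw [h]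
    _ = ‖A * (A * radialUnit x - star A * radialUnit x * A * A)‖ := by rw [norm_mul, hA, one_mul]
    _ = ‖A * A * radialUnit x - radialUnit x * A * A‖ := by rw [h2]

end Summit.QuantumFields.YangMills.Theorems.SwapVirialDeficit.ZeroModeSigma

end
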